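import Literature.AlgebraicGeometry.Motives.AbelianVarietyInducedActionExistence
import HarnessLib

/-!
# Induction is a functor and preserves equivariant isogenies: an `H`-map `u : (Y, α) → (Y', α')` induces a unique `G`-map
# `Ind u : Ind_H^G Y → Ind_H^G Y'`, compatibly with composition, and an `H`-equivariant isogeny pair `u u' = n = u' u`
# induces a `G`-equivariant isogeny pair — `Ind_H^G Y ∼ Ind_H^G Y'` (any characteristic)

Sequel of `Motives/AbelianVarietyInducedActionExistence` (Serre's Lemma 1: `comm_ext_of_ι_comp_eq`, `exists_comm_and_ι_comp_eq`).
Two imprimitive systems over the SAME transitive finite `G`-set `T ∋ t₀`: `X = ⊕_{t ∈ T} Y` (bicone `b`, `Σ π_t ≫ ι_t = 𝟙`,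
action `ρ` with `ι_t ρ(g) π_u = 0` for `u ≠ g t`, stabiliser action `α(h) = ι_{t₀} ρ(h) π_{t₀}` of `H = Stab(t₀)`) and
`X' = ⊕_{t ∈ T} Y'` (bicone `b'`, action `ρ'`, stabiliser action `α'`), i.e. `X = Ind_H^G (Y, α)`, `X' = Ind_H^G (Y', α')`.
Since `Ind_H^G W = ℂ[G] ⊗_{ℂ[H]} W` is a functor of `W` (Serre §7.1), every `H`-map induces a `G`-map; on abelian varieties:

* §1 FUNCTORIALITY: an `H`-equivariant `u : Y → Y'` (`α(h) ≫ u = u ≫ α'(h)`) has a UNIQUE `G`-equivariant extension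
  `F = Ind u : X → X'` with **`ι_{t₀} ≫ F = u ≫ ι'_{t₀}`** (`exists_induced_hom`, `induced_hom_unique`); `Ind 𝟙 = 𝟙`, `Ind` of a
  composite is the composite, `Ind (n • u) = n • Ind u` (`comm_and_ι_comp_eq_id/comp/zsmul`);
* §2 ISOGENIES: if `u ≫ u' = n • 𝟙_Y` for `H`-maps `u : Y → Y'`, `u' : Y' → Y` then **`Ind u ≫ Ind u' = n • 𝟙_X`**
  (`induced_hom_comp_eq_zsmul_id`, uniqueness applied to the two extensions of `n • 𝟙`); hence for an `H`-EQUIVARIANT ISOGENY PAIR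
  (`u u' = n = u' u`, `n ≠ 0`) the induced maps are a `G`-EQUIVARIANT ISOGENY PAIR (`isIsogeny_induced_hom`: `[n]` is an isogeny
  in every characteristic, the tree's `isIsogeny_zsmul_id_holds`, and `isIsogeny_of_comp_eq_of_comp_eq`) and
  **`Ind_H^G Y ∼ Ind_H^G Y'`** (`exists_equivariant_isogeny_of_induced`, `isIsogenous_of_induced`).

Everything is a theorem; `K` any field, `G` arbitrary, `T` finite.

## References

* [SerreLinearRepresentations1977] J.-P. Serre, *Linear Representations of Finite Groups*, GTM 42 (1977): §3.3 Lemma 1, Thm. 11,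
  §7.1 (`Ind_H^G W = ℂ[G] ⊗_{ℂ[H]} W`, Remarks (1)–(2)).  Held: `book:serre1977-linear-representations-finite-groups`, PDF pp. 30–31, 50.
* [MumfordAV1970] D. Mumford, *Abelian Varieties* (1970), §19 (remark before Thm. 1, p. 169: isogenies have quasi-inverses
  `g ∘ f = [n]`), §6 Application 3 (p. 64: `[n]` is an isogeny).
* [Milne1986AbelianVarieties] J. S. Milne, *Abelian varieties*, in Cornell–Silverman (1986), §8 (isogenies).
* [LangeRodriguez2022] H. Lange, R. E. Rodríguez, *Decomposition of Jacobians by Prym Varieties*, LNM 2310 (2022), §3.5 (isogenous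
  decompositions of induced actions).
-/

noncomputable section

open CategoryTheory CategoryTheory.Limits MulAction
open Literature.NumberTheory.DiophantineGeometry

universe u

namespace Literature.AlgebraicGeometry.Motives

namespace AbelianVariety

namespace Imprimitive

variable {K : Type u} [Field K]

variable {Y Y' Y'' : AbelianVariety K} {T : Type} [Fintype T] (b : Bicone (fun _ : T ↦ Y)) (b' : Bicone (fun _ : T ↦ Y'))
  (b'' : Bicone (fun _ : T ↦ Y''))
  {G : Type} [Group G] [MulAction G T] (ρ : G →* End b.pt) (ρ' : G →* End b'.pt) (ρ'' : G →* End b''.pt) (t₀ : T)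
  (α : stabilizer G t₀ →* End Y) (α' : stabilizer G t₀ →* End Y') (α'' : stabilizer G t₀ →* End Y'')

/-! ## §1 `Ind` is a functor: `H`-maps `(Y, α) → (Y', α')` extend uniquely to `G`-maps `Ind Y → Ind Y'` -/

/-- **`Ind u` exists**: an `H`-equivariant `u : Y → Y'` (`α(h) ≫ u = u ≫ α'(h)`) extends to a `G`-equivariant `F : X → X'` with
`ι_{t₀} ≫ F = u ≫ ι'_{t₀}` (Lemma 1 applied to `u ≫ ι'_{t₀} : Y → Res X'`, an `H`-map since `ι'_{t₀}` is).
[cite: SerreLinearRepresentations1977, §3.3 Lemma 1 and §7.1 (functoriality of `ℂ[G] ⊗_{ℂ[H]} W`)] -/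
theorem exists_induced_hom [IsPretransitive G T] (hb : ∑ t, b.π t ≫ b.ι t = 𝟙 b.pt)
    (hρ : ∀ (g : G) (t u : T), g • t ≠ u → b.ι t ≫ End.asHom (ρ g) ≫ b.π u = 0)
    (hb' : ∑ t, b'.π t ≫ b'.ι t = 𝟙 b'.pt)
    (hρ' : ∀ (g : G) (t u : T), g • t ≠ u → b'.ι t ≫ End.asHom (ρ' g) ≫ b'.π u = 0)
    (hα : ∀ h : stabilizer G t₀, End.asHom (α h) = b.ι t₀ ≫ End.asHom (ρ h) ≫ b.π t₀)
    (hα' : ∀ h : stabilizer G t₀, End.asHom (α' h) = b'.ι t₀ ≫ End.asHom (ρ' h) ≫ b'.π t₀) {u : Y ⟶ Y'}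
    (hu : ∀ h : stabilizer G t₀, End.asHom (α h) ≫ u = u ≫ End.asHom (α' h)) :
    ∃ F : b.pt ⟶ b'.pt, (∀ g : G, End.asHom (ρ g) ≫ F = F ≫ End.asHom (ρ' g)) ∧ b.ι t₀ ≫ F = u ≫ b'.ι t₀ :=
  exists_comm_and_ι_comp_eq b ρ ρ' t₀ α hb hρ hα fun h ↦ by
    rw [← Category.assoc, hu h, Category.assoc, stabilizerAction_comp_ι_eq b' ρ' t₀ hb' hρ' hα' h, Category.assoc]

/-- **`Ind u` is unique**: two `G`-maps `X → X'` extending the same `u` on `Y_{t₀}` coincide.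
[cite: SerreLinearRepresentations1977, §3.3 Lemma 1 (uniqueness)] -/
theorem induced_hom_unique [IsPretransitive G T] (hb : ∑ t, b.π t ≫ b.ι t = 𝟙 b.pt)
    (hρ : ∀ (g : G) (t u : T), g • t ≠ u → b.ι t ≫ End.asHom (ρ g) ≫ b.π u = 0) {u : Y ⟶ Y'} {F F' : b.pt ⟶ b'.pt}
    (hF : ∀ g : G, End.asHom (ρ g) ≫ F = F ≫ End.asHom (ρ' g)) (hF0 : b.ι t₀ ≫ F = u ≫ b'.ι t₀)
    (hF' : ∀ g : G, End.asHom (ρ g) ≫ F' = F' ≫ End.asHom (ρ' g)) (hF'0 : b.ι t₀ ≫ F' = u ≫ b'.ι t₀) : F = F' :=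
  comm_ext_of_ι_comp_eq b ρ ρ' t₀ hb hρ hF hF' (hF0.trans hF'0.symm)

omit [Fintype T] [MulAction G T] in
/-- `Ind 𝟙 = 𝟙`: the identity of `X` is `G`-equivariant and extends `𝟙_Y`. [cite: SerreLinearRepresentations1977, §7.1] -/
theorem comm_and_ι_comp_eq_id :
    (∀ g : G, End.asHom (ρ g) ≫ 𝟙 b.pt = 𝟙 b.pt ≫ End.asHom (ρ g)) ∧ b.ι t₀ ≫ 𝟙 b.pt = 𝟙 Y ≫ b.ι t₀ :=
  ⟨fun g ↦ by rw [Category.comp_id, Category.id_comp], by rw [Category.comp_id, Category.id_comp]⟩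

omit [Fintype T] [MulAction G T] in
/-- `Ind (u ≫ u') = Ind u ≫ Ind u'`: composites of equivariant extensions are equivariant extensions of the composite.
[cite: SerreLinearRepresentations1977, §7.1] -/
theorem comm_and_ι_comp_eq_comp {u : Y ⟶ Y'} {u' : Y' ⟶ Y''} {F : b.pt ⟶ b'.pt} {F' : b'.pt ⟶ b''.pt}
    (hF : ∀ g : G, End.asHom (ρ g) ≫ F = F ≫ End.asHom (ρ' g)) (hF0 : b.ι t₀ ≫ F = u ≫ b'.ι t₀)
    (hF' : ∀ g : G, End.asHom (ρ' g) ≫ F' = F' ≫ End.asHom (ρ'' g)) (hF'0 : b'.ι t₀ ≫ F' = u' ≫ b''.ι t₀) :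
    (∀ g : G, End.asHom (ρ g) ≫ (F ≫ F') = (F ≫ F') ≫ End.asHom (ρ'' g)) ∧ b.ι t₀ ≫ (F ≫ F') = (u ≫ u') ≫ b''.ι t₀ :=
  ⟨fun g ↦ by rw [← Category.assoc, hF g, Category.assoc, hF' g, Category.assoc],
    by rw [← Category.assoc, hF0, Category.assoc, hF'0, Category.assoc]⟩

omit [Fintype T] [MulAction G T] in
/-- `Ind (n • u) = n • Ind u`. [cite: SerreLinearRepresentations1977, §7.1] -/
theorem comm_and_ι_comp_eq_zsmul {u : Y ⟶ Y'} {F : b.pt ⟶ b'.pt}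
    (hF : ∀ g : G, End.asHom (ρ g) ≫ F = F ≫ End.asHom (ρ' g)) (hF0 : b.ι t₀ ≫ F = u ≫ b'.ι t₀) (n : ℤ) :
    (∀ g : G, End.asHom (ρ g) ≫ (n • F) = (n • F) ≫ End.asHom (ρ' g)) ∧ b.ι t₀ ≫ (n • F) = (n • u) ≫ b'.ι t₀ :=
  ⟨fun g ↦ by rw [Preadditive.comp_zsmul, hF g, Preadditive.zsmul_comp],
    by rw [Preadditive.comp_zsmul, hF0, Preadditive.zsmul_comp]⟩

/-! ## §2 `Ind` preserves equivariant isogenies -/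

/-- **`Ind u ≫ Ind u' = n • 𝟙_X` when `u ≫ u' = n • 𝟙_Y`**: both sides are `G`-equivariant and extend `n • 𝟙_Y`
(`ι_{t₀} ≫ Ind u ≫ Ind u' = u ≫ u' ≫ ι_{t₀} = n • ι_{t₀}`), so they agree by the uniqueness in Lemma 1.
[cite: SerreLinearRepresentations1977, §3.3 Lemma 1] [cite: MumfordAV1970, §19 (remark before Thm. 1, p. 169)] -/
theorem induced_hom_comp_eq_zsmul_id [IsPretransitive G T] (hb : ∑ t, b.π t ≫ b.ι t = 𝟙 b.pt)
    (hρ : ∀ (g : G) (t u : T), g • t ≠ u → b.ι t ≫ End.asHom (ρ g) ≫ b.π u = 0) {u : Y ⟶ Y'} {u' : Y' ⟶ Y} {n : ℤ}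
    (huu' : u ≫ u' = n • 𝟙 Y) {F : b.pt ⟶ b'.pt} {F' : b'.pt ⟶ b.pt}
    (hF : ∀ g : G, End.asHom (ρ g) ≫ F = F ≫ End.asHom (ρ' g)) (hF0 : b.ι t₀ ≫ F = u ≫ b'.ι t₀)
    (hF' : ∀ g : G, End.asHom (ρ' g) ≫ F' = F' ≫ End.asHom (ρ g)) (hF'0 : b'.ι t₀ ≫ F' = u' ≫ b.ι t₀) :
    F ≫ F' = n • 𝟙 b.pt := by
  have h1 := comm_and_ι_comp_eq_comp b b' b ρ ρ' ρ t₀ hF hF0 hF' hF'0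
  have h2 := comm_and_ι_comp_eq_zsmul b b ρ ρ t₀ (comm_and_ι_comp_eq_id b ρ t₀).1 (comm_and_ι_comp_eq_id b ρ t₀).2 n
  refine comm_ext_of_ι_comp_eq b ρ ρ t₀ hb hρ h1.1 h2.1 ?_
  rw [h1.2, h2.2, huu']

/-- **`Ind` of an `H`-equivariant isogeny pair is a `G`-equivariant isogeny pair**: if `u : Y → Y'`, `u' : Y' → Y` are
`H`-equivariant with `u ≫ u' = n • 𝟙`, `u' ≫ u = n • 𝟙`, `n ≠ 0`, then their induced extensions `F`, `F'` satisfy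
`F ≫ F' = n • 𝟙`, `F' ≫ F = n • 𝟙`, and BOTH ARE ISOGENIES (any characteristic: `[n]` is an isogeny, the tree's
`isIsogeny_zsmul_id_holds`). [cite: MumfordAV1970, §19 (p. 169) and §6 Application 3 (p. 64)] [cite: SerreLinearRepresentations1977, §3.3 Lemma 1] -/
theorem isIsogeny_induced_hom [IsPretransitive G T] (hb : ∑ t, b.π t ≫ b.ι t = 𝟙 b.pt)
    (hρ : ∀ (g : G) (t u : T), g • t ≠ u → b.ι t ≫ End.asHom (ρ g) ≫ b.π u = 0)
    (hb' : ∑ t, b'.π t ≫ b'.ι t = 𝟙 b'.pt)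
    (hρ' : ∀ (g : G) (t u : T), g • t ≠ u → b'.ι t ≫ End.asHom (ρ' g) ≫ b'.π u = 0) {u : Y ⟶ Y'} {u' : Y' ⟶ Y} {n : ℤ}
    (hn : n ≠ 0) (huu' : u ≫ u' = n • 𝟙 Y) (hu'u : u' ≫ u = n • 𝟙 Y') {F : b.pt ⟶ b'.pt} {F' : b'.pt ⟶ b.pt}
    (hF : ∀ g : G, End.asHom (ρ g) ≫ F = F ≫ End.asHom (ρ' g)) (hF0 : b.ι t₀ ≫ F = u ≫ b'.ι t₀)
    (hF' : ∀ g : G, End.asHom (ρ' g) ≫ F' = F' ≫ End.asHom (ρ g)) (hF'0 : b'.ι t₀ ≫ F' = u' ≫ b.ι t₀) :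
    IsIsogeny F ∧ IsIsogeny F' ∧ F ≫ F' = n • 𝟙 b.pt ∧ F' ≫ F = n • 𝟙 b'.pt := by
  have h1 := induced_hom_comp_eq_zsmul_id b b' ρ ρ' t₀ hb hρ huu' hF hF0 hF' hF'0
  have h2 := induced_hom_comp_eq_zsmul_id b' b ρ' ρ t₀ hb' hρ' hu'u hF' hF'0 hF hF0
  exact ⟨isIsogeny_of_comp_eq_of_comp_eq (isIsogeny_zsmul_id_holds b'.pt n hn) (isIsogeny_zsmul_id_holds b.pt n hn) h2 h1,
    isIsogeny_of_comp_eq_of_comp_eq (isIsogeny_zsmul_id_holds b.pt n hn) (isIsogeny_zsmul_id_holds b'.pt n hn) h1 h2, h1, h2⟩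

/-- **`Ind_H^G Y → Ind_H^G Y'` is a `G`-EQUIVARIANT ISOGENY** when `(Y, α)` and `(Y', α')` are related by an `H`-equivariant
isogeny pair (`u u' = n • 𝟙 = u' u`, `n ≠ 0`, `u`, `u'` both `H`-equivariant): there is an isogeny `F : X → X'` with
`ρ(g) ≫ F = F ≫ ρ'(g)` and `ι_{t₀} ≫ F = u ≫ ι'_{t₀}`. [cite: SerreLinearRepresentations1977, §3.3 Lemma 1 and Thm. 11]
[cite: MumfordAV1970, §19 (p. 169)] [cite: LangeRodriguez2022, §3.5] -/
theorem exists_equivariant_isogeny_of_induced [IsPretransitive G T] (hb : ∑ t, b.π t ≫ b.ι t = 𝟙 b.pt)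
    (hρ : ∀ (g : G) (t u : T), g • t ≠ u → b.ι t ≫ End.asHom (ρ g) ≫ b.π u = 0)
    (hb' : ∑ t, b'.π t ≫ b'.ι t = 𝟙 b'.pt)
    (hρ' : ∀ (g : G) (t u : T), g • t ≠ u → b'.ι t ≫ End.asHom (ρ' g) ≫ b'.π u = 0)
    (hα : ∀ h : stabilizer G t₀, End.asHom (α h) = b.ι t₀ ≫ End.asHom (ρ h) ≫ b.π t₀)
    (hα' : ∀ h : stabilizer G t₀, End.asHom (α' h) = b'.ι t₀ ≫ End.asHom (ρ' h) ≫ b'.π t₀) {u : Y ⟶ Y'} {u' : Y' ⟶ Y}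
    {n : ℤ} (hn : n ≠ 0) (huu' : u ≫ u' = n • 𝟙 Y) (hu'u : u' ≫ u = n • 𝟙 Y')
    (hu : ∀ h : stabilizer G t₀, End.asHom (α h) ≫ u = u ≫ End.asHom (α' h))
    (hu' : ∀ h : stabilizer G t₀, End.asHom (α' h) ≫ u' = u' ≫ End.asHom (α h)) :
    ∃ F : b.pt ⟶ b'.pt, IsIsogeny F ∧ (∀ g : G, End.asHom (ρ g) ≫ F = F ≫ End.asHom (ρ' g)) ∧
      b.ι t₀ ≫ F = u ≫ b'.ι t₀ := by
  obtain ⟨F, hF, hF0⟩ := exists_induced_hom b b' ρ ρ' t₀ α α' hb hρ hb' hρ' hα hα' hu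
  obtain ⟨F', hF', hF'0⟩ := exists_induced_hom b' b ρ' ρ t₀ α' α hb' hρ' hb hρ hα' hα hu'
  exact ⟨F, (isIsogeny_induced_hom b b' ρ ρ' t₀ hb hρ hb' hρ' hn huu' hu'u hF hF0 hF' hF'0).1, hF, hF0⟩

/-- **`Ind_H^G Y ∼ Ind_H^G Y'`** for `H`-equivariantly isogenous inducing data (as in `exists_equivariant_isogeny_of_induced`).
[cite: SerreLinearRepresentations1977, §3.3 Thm. 11] [cite: MumfordAV1970, §19 (p. 169)] [cite: LangeRodriguez2022, §3.5] -/
theorem isIsogenous_of_induced [IsPretransitive G T] (hb : ∑ t, b.π t ≫ b.ι t = 𝟙 b.pt)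
    (hρ : ∀ (g : G) (t u : T), g • t ≠ u → b.ι t ≫ End.asHom (ρ g) ≫ b.π u = 0)
    (hb' : ∑ t, b'.π t ≫ b'.ι t = 𝟙 b'.pt)
    (hρ' : ∀ (g : G) (t u : T), g • t ≠ u → b'.ι t ≫ End.asHom (ρ' g) ≫ b'.π u = 0)
    (hα : ∀ h : stabilizer G t₀, End.asHom (α h) = b.ι t₀ ≫ End.asHom (ρ h) ≫ b.π t₀)
    (hα' : ∀ h : stabilizer G t₀, End.asHom (α' h) = b'.ι t₀ ≫ End.asHom (ρ' h) ≫ b'.π t₀) {u : Y ⟶ Y'} {u' : Y' ⟶ Y}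
    {n : ℤ} (hn : n ≠ 0) (huu' : u ≫ u' = n • 𝟙 Y) (hu'u : u' ≫ u = n • 𝟙 Y')
    (hu : ∀ h : stabilizer G t₀, End.asHom (α h) ≫ u = u ≫ End.asHom (α' h))
    (hu' : ∀ h : stabilizer G t₀, End.asHom (α' h) ≫ u' = u' ≫ End.asHom (α h)) :
    IsIsogenous b.pt b'.pt := by
  obtain ⟨F, hF, -, -⟩ := exists_equivariant_isogeny_of_induced b b' ρ ρ' t₀ α α' hb hρ hb' hρ' hα hα' hn huu' hu'u hu hu'
  exact ⟨F, hF⟩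

end Imprimitive

end AbelianVariety

end Literature.AlgebraicGeometry.Motives
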